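import Literature.MathematicalPhysics.StatisticalMechanics.BarlowStacking
import Literature.MathematicalPhysics.StatisticalMechanics.HcpSiteGeometry
import Literature.MathematicalPhysics.StatisticalMechanics.MuGroundStateConfiguration

/-!
# Route `GscTwinLoopSurgery`, support item `GscHingeGlue` (stmt-AtomisticToContinuum-14087): Barlow-stacking geometry

Elementary facts about the point sets `barlowStacking a h s` (`BarlowStacking.lean`) needed by
the compactness arguments of the glue `GscHingeGlue`:

* labels: `abs_haggLabel_le`
  (`|L k| ≤ |k|` for a `±1` word), `haggLabel_congr` (the label of layer `k` only depends on the
  word on `|m| ≤ |k|`);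
* `barlowPos_sub_barlowPos`, `image_sub_barlowStacking` — translating the stacking by one of its
  points `barlowPos a h s K i₀ j₀` gives the stacking of the shifted word `s (· + K)`;
* `exists_barlowPos_near` — crude covering radius `a + h`;
* `barlowPos_eq_smul_add_smul`, `tendsto_barlowPos` — the sites depend linearly on `(a, h)`
  (for a fixed label), hence continuously;
* `barlow_index_mem_box` — sites of norm `≤ M` have indices of size `≤ 10 M` (`a, h ≥ 1/2`);
* `eventually_ballMatch_barlowStacking` — if `(aₙ, hₙ) → (a, h)` and the words `sₙ → s`
  pointwise, the stackings converge in the local matching sense (`BallMatch` on every ball);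
* `dist_sub_sub_le_of_params` — changing `(a, h)` by `≤ η` moves relative position vectors of
  sites by `≤ 2η ×` their length.

All `[folklore]`; nothing here closes an item.
-/

noncomputable section

open scoped BigOperators Topology
open Filter Set Metric

namespace Summit.AtomisticToContinuum.Crystallization.Theorems.GscHingeGlue

open Literature.MathematicalPhysics.StatisticalMechanics

/-! ## Labels -/

/-- Labels of the shifted word: `L_s (k + K) = L_{s(·+K)} k + L_s K`. [folklore] -/
private theorem haggLabel_add_eq_shift (s : ℤ → ℤ) (K k : ℤ) :
    haggLabel s (k + K) = haggLabel (fun m => s (m + K)) k + haggLabel s K := by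
  induction k using Int.induction_on with
  | zero => simp
  | succ n ih =>
    rw [show (n : ℤ) + 1 + K = (n + K) + 1 by ring, haggLabel_succ, ih, haggLabel_succ]
    ring
  | pred n ih =>
    have h1 := haggLabel_succ (fun m => s (m + K)) (-(n : ℤ) - 1)
    have h2 := haggLabel_succ s (-(n : ℤ) - 1 + K)
    rw [show -(n : ℤ) - 1 + 1 = -(n : ℤ) by ring] at h1
    rw [show -(n : ℤ) - 1 + K + 1 = -(n : ℤ) + K by ring, ih] at h2
    linarith

/-- Window sums of a `±1` word of length `k` are bounded by `k`. [folklore] -/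
theorem abs_haggWindow_le {s : ℤ → ℤ} (hs : IsHaggSeq s) (m : ℤ) (k : ℕ) :
    |haggWindow s m k| ≤ k := by
  induction k with
  | zero => simp
  | succ k ih =>
    rw [haggWindow_succ]
    have h1 : |s (m + k)| ≤ 1 := by rcases hs (m + k) with h | h <;> simp [h]
    calc |haggWindow s m k + s (m + k)| ≤ |haggWindow s m k| + |s (m + k)| := abs_add_le _ _
      _ ≤ (k : ℤ) + 1 := add_le_add ih h1
      _ = ((k + 1 : ℕ) : ℤ) := by push_cast; ring

/-- `|L k| ≤ |k|` for a `±1` word. [folklore] -/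
theorem abs_haggLabel_le {s : ℤ → ℤ} (hs : IsHaggSeq s) (k : ℤ) : |haggLabel s k| ≤ |k| := by
  unfold haggLabel
  split_ifs with hk
  · calc |haggWindow s 0 k.toNat| ≤ (k.toNat : ℤ) := abs_haggWindow_le hs 0 _
      _ = k := Int.toNat_of_nonneg hk
      _ = |k| := (abs_of_nonneg hk).symm
  · rw [abs_neg]
    push Not at hk
    calc |haggWindow s k (-k).toNat| ≤ ((-k).toNat : ℤ) := abs_haggWindow_le hs k _
      _ = -k := Int.toNat_of_nonneg (by omega)
      _ = |k| := (abs_of_neg hk).symm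

/-- Window sums only depend on the word on the window. [folklore] -/
theorem haggWindow_congr {s s' : ℤ → ℤ} {m : ℤ} {k : ℕ}
    (h : ∀ i : ℕ, i < k → s' (m + i) = s (m + i)) : haggWindow s' m k = haggWindow s m k :=
  Finset.sum_congr rfl fun i hi => h i (Finset.mem_range.1 hi)

/-- The label of layer `k` only depends on the word on `{m : |m| ≤ |k|}`. [folklore] -/
theorem haggLabel_congr {s s' : ℤ → ℤ} {k : ℤ} (h : ∀ m : ℤ, |m| ≤ |k| → s' m = s m) :
    haggLabel s' k = haggLabel s k := by
  unfold haggLabel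
  split_ifs with hk
  · refine haggWindow_congr fun i hi => h _ ?_
    have hi' : (i : ℤ) < k := Int.lt_toNat.1 hi
    rw [zero_add, abs_of_nonneg (by positivity), abs_of_nonneg hk]
    exact hi'.le
  · push Not at hk
    congr 1
    refine haggWindow_congr fun i hi => h _ ?_
    have hi' : (i : ℤ) < -k := Int.lt_toNat.1 hi
    rw [abs_of_neg hk, abs_le]
    constructor <;> omega

/-- A shifted `±1` word is a `±1` word. [folklore] -/
theorem isHaggSeq_shift {s : ℤ → ℤ} (hs : IsHaggSeq s) (K : ℤ) : IsHaggSeq fun m => s (m + K) :=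
  fun m => hs (m + K)

/-! ## Translation by a site shifts the word -/

/-- `barlowPos (k + K) (i + i₀) (j + j₀) - barlowPos K i₀ j₀` is the site `(k, i, j)` of the
stacking of the shifted word `s (· + K)`. [folklore] -/
theorem barlowPos_sub_barlowPos (a h : ℝ) (s : ℤ → ℤ) (K i₀ j₀ k i j : ℤ) :
    barlowPos a h s (k + K) (i + i₀) (j + j₀) - barlowPos a h s K i₀ j₀ =
      barlowPos a h (fun m => s (m + K)) k i j := by
  simp only [barlowPos, haggLabel_add_eq_shift s K k, Int.cast_add]
  module

/-- **Translating a Barlow stacking by one of its sites gives the stacking of the shifted word**: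
`barlowStacking a h s - barlowPos a h s K i₀ j₀ = barlowStacking a h (s (· + K))`. [folklore] -/
theorem image_sub_barlowStacking (a h : ℝ) (s : ℤ → ℤ) (K i₀ j₀ : ℤ) :
    (fun p => p - barlowPos a h s K i₀ j₀) '' barlowStacking a h s =
      barlowStacking a h (fun m => s (m + K)) := by
  ext p
  simp only [mem_image, mem_barlowStacking_iff]
  constructor
  · rintro ⟨_, ⟨k, i, j, rfl⟩, rfl⟩
    refine ⟨k - K, i - i₀, j - j₀, ?_⟩
    rw [← barlowPos_sub_barlowPos, sub_add_cancel, sub_add_cancel, sub_add_cancel]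
  · rintro ⟨k, i, j, rfl⟩
    exact ⟨_, ⟨k + K, i + i₀, j + j₀, rfl⟩, barlowPos_sub_barlowPos a h s K i₀ j₀ k i j⟩

/-! ## Covering radius -/

/-- **Crude covering radius**: every point of `ℝ³` is within `a + h` of a site of
`barlowStacking a h s` (`0 < a`, `0 < h`): round the height to the nearest layer and the two
in-layer coordinates to the nearest integers. [folklore] -/
theorem exists_barlowPos_near {a h : ℝ} (ha : 0 < a) (hh : 0 < h) (s : ℤ → ℤ)
    (z : EuclideanSpace ℝ (Fin 3)) :
    ∃ K i j : ℤ, dist z (barlowPos a h s K i j) ≤ a + h := by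
  obtain ⟨t, ht⟩ : ∃ t : ℝ, t = z 2 / h := ⟨_, rfl⟩
  set K : ℤ := round t with hK
  obtain ⟨β, hβ⟩ : ∃ β : ℝ, β = z 1 / (a * √3 / 2) - (haggLabel s K : ℝ) / 3 := ⟨_, rfl⟩
  set j : ℤ := round β with hj
  obtain ⟨α, hα⟩ : ∃ α : ℝ, α = z 0 / a - (j : ℝ) / 2 - (haggLabel s K : ℝ) / 2 := ⟨_, rfl⟩
  set i : ℤ := round α with hi
  refine ⟨K, i, j, ?_⟩
  have h3 : (√3 : ℝ) ^ 2 = 3 := Real.sq_sqrt (by norm_num)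
  have h3pos : (0 : ℝ) < √3 := by positivity
  have hz0 : z 0 = a * (α + j / 2 + haggLabel s K / 2) := by rw [hα]; field_simp; ring
  have hz1 : z 1 = a * √3 / 2 * (β + haggLabel s K / 3) := by rw [hβ]; field_simp; ring
  have hz2 : z 2 = h * t := by rw [ht]; field_simp
  have hsq : dist z (barlowPos a h s K i j) ^ 2 =
      (a * (α - round α)) ^ 2 + (a * √3 / 2 * (β - round β)) ^ 2 + (h * (t - round t)) ^ 2 := by
    rw [EuclideanSpace.dist_sq_eq, Fin.sum_univ_three, Real.dist_eq, Real.dist_eq, Real.dist_eq,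
      sq_abs, sq_abs, sq_abs, barlowPos_apply_zero, barlowPos_apply_one, barlowPos_apply_two,
      hz0, hz1, hz2]
    ring
  have hx := sq_sub_round_le_quarter α
  have hy := sq_sub_round_le_quarter β
  have htt := sq_sub_round_le_quarter t
  have hle : dist z (barlowPos a h s K i j) ^ 2 ≤ (a + h) ^ 2 := by
    rw [hsq]
    have e1 : (a * (α - round α)) ^ 2 ≤ a ^ 2 / 4 := by
      rw [mul_pow]; nlinarith [sq_nonneg a]
    have e2 : (a * √3 / 2 * (β - round β)) ^ 2 ≤ 3 * a ^ 2 / 16 := by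
      rw [mul_pow, show (a * √3 / 2) ^ 2 = 3 * a ^ 2 / 4 by rw [div_pow, mul_pow, h3]; ring]
      nlinarith [sq_nonneg a]
    have e3 : (h * (t - round t)) ^ 2 ≤ h ^ 2 / 4 := by
      rw [mul_pow]; nlinarith [sq_nonneg h]
    nlinarith [mul_pos ha hh]
  exact (pow_le_pow_iff_left₀ dist_nonneg (by positivity) two_ne_zero).1 hle

/-! ## Linearity and continuity in the parameters -/

/-- The sites depend linearly on `(a, h)`:
`barlowPos a h s k i j = a • barlowPos 1 0 s k i j + h • (k • e₃)`. [folklore] -/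
theorem barlowPos_eq_smul_add_smul (a h : ℝ) (s : ℤ → ℤ) (k i j : ℤ) :
    barlowPos a h s k i j = a • barlowPos 1 0 s k i j + h • ((k : ℝ) • layerNormal 1) := by
  ext l
  fin_cases l <;> simp [layerNormal] <;> ring

/-- Sites with the same label coincide. [folklore] -/
theorem barlowPos_congr_label {s s' : ℤ → ℤ} {k : ℤ} (hL : haggLabel s' k = haggLabel s k)
    (a h : ℝ) (i j : ℤ) : barlowPos a h s' k i j = barlowPos a h s k i j := by
  simp only [barlowPos, hL]

/-- **Continuity of the sites in the data**: if `aₙ → a`, `hₙ → h` and the label of layer `k`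
is eventually that of the limit word, the site `(k, i, j)` converges. [folklore] -/
theorem tendsto_barlowPos {aseq hseq : ℕ → ℝ} {ss : ℕ → ℤ → ℤ} {a h : ℝ} {s : ℤ → ℤ} {k : ℤ}
    (ha : Tendsto aseq atTop (𝓝 a)) (hh : Tendsto hseq atTop (𝓝 h))
    (hL : ∀ᶠ n in atTop, haggLabel (ss n) k = haggLabel s k) (i j : ℤ) :
    Tendsto (fun n => barlowPos (aseq n) (hseq n) (ss n) k i j) atTop
      (𝓝 (barlowPos a h s k i j)) := by
  have hlim : Tendsto (fun n => aseq n • barlowPos 1 0 s k i j + hseq n • ((k : ℝ) • layerNormal 1))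
      atTop (𝓝 (barlowPos a h s k i j)) := by
    rw [barlowPos_eq_smul_add_smul a h s k i j]
    exact (ha.smul_const _).add (hh.smul_const _)
  refine hlim.congr' ?_
  filter_upwards [hL] with n hn
  rw [barlowPos_eq_smul_add_smul (aseq n) (hseq n) (ss n) k i j, barlowPos_congr_label hn]

/-! ## Index bounds -/

/-- **Index bounds**: a site of norm `≤ M` of a stacking with `a, h ≥ 1/2` and a `±1` word has
layer index `|k| ≤ 2M` and in-layer indices `|j| ≤ 6M`, `|i| ≤ 10M`. [folklore] -/
theorem barlow_index_bounds {a h : ℝ} (ha : 1 / 2 ≤ a) (hh : 1 / 2 ≤ h) {s : ℤ → ℤ}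
    (hs : IsHaggSeq s) {k i j : ℤ} {M : ℝ} (hM : ‖barlowPos a h s k i j‖ ≤ M) :
    |(k : ℝ)| ≤ 2 * M ∧ |(j : ℝ)| ≤ 6 * M ∧ |(i : ℝ)| ≤ 10 * M := by
  have hco : ∀ l : Fin 3, |barlowPos a h s k i j l| ≤ ‖barlowPos a h s k i j‖ := fun l => by
    simpa [Real.norm_eq_abs] using PiLp.norm_apply_le (barlowPos a h s k i j) l
  have h0 := hco 0
  have h1 := hco 1
  have h2 := hco 2
  rw [barlowPos_apply_zero] at h0
  rw [barlowPos_apply_one] at h1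
  rw [barlowPos_apply_two] at h2
  have hL : |(haggLabel s k : ℝ)| ≤ |(k : ℝ)| := by exact_mod_cast abs_haggLabel_le hs k
  have h3 : (1 : ℝ) ≤ √3 := by
    rw [show (1 : ℝ) = √1 from Real.sqrt_one.symm]
    exact Real.sqrt_le_sqrt (by norm_num)
  have hM0 : 0 ≤ M := (norm_nonneg _).trans hM
  -- layer index
  have hk : |(k : ℝ)| ≤ 2 * M := by
    rw [abs_mul, abs_of_nonneg (by linarith : (0 : ℝ) ≤ h)] at h2
    have : |(k : ℝ)| * (1 / 2) ≤ M := by nlinarith [abs_nonneg (k : ℝ)]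
    linarith
  -- second in-layer index
  have hj : |(j : ℝ)| ≤ 6 * M := by
    rw [abs_mul, abs_of_nonneg (by positivity : (0 : ℝ) ≤ a * √3 / 2)] at h1
    have hc : (1 : ℝ) / 4 ≤ a * √3 / 2 := by nlinarith
    have h1' : |(j : ℝ) + haggLabel s k / 3| * (1 / 4) ≤ M := by
      nlinarith [abs_nonneg ((j : ℝ) + haggLabel s k / 3)]
    have h1'' : |(j : ℝ)| ≤ |(j : ℝ) + haggLabel s k / 3| + |(haggLabel s k : ℝ)| / 3 := by
      have := abs_sub_le (j : ℝ) ((j : ℝ) + haggLabel s k / 3) 0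
      have e : |(j : ℝ) + haggLabel s k / 3 - 0| = |(j : ℝ) + haggLabel s k / 3| := by
        rw [sub_zero]
      have e' : |(j : ℝ) - ((j : ℝ) + haggLabel s k / 3)| = |(haggLabel s k : ℝ)| / 3 := by
        rw [show (j : ℝ) - ((j : ℝ) + haggLabel s k / 3) = -((haggLabel s k : ℝ) / 3) by ring,
          abs_neg, abs_div, abs_of_pos (by norm_num : (0 : ℝ) < 3)]
      rw [sub_zero, e, e'] at this
      linarith
    nlinarith [abs_nonneg (j : ℝ)]
  refine ⟨hk, hj, ?_⟩
  -- first in-layer index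
  rw [abs_mul, abs_of_nonneg (by linarith : (0 : ℝ) ≤ a)] at h0
  have h0' : |(i : ℝ) + j / 2 + haggLabel s k / 2| * (1 / 2) ≤ M := by
    nlinarith [abs_nonneg ((i : ℝ) + j / 2 + haggLabel s k / 2)]
  have h0'' : |(i : ℝ)| ≤ |(i : ℝ) + j / 2 + haggLabel s k / 2| + |(j : ℝ)| / 2 +
      |(haggLabel s k : ℝ)| / 2 := by
    have e : (i : ℝ) = ((i : ℝ) + j / 2 + haggLabel s k / 2) + (-((j : ℝ) / 2)) +
        (-((haggLabel s k : ℝ) / 2)) := by ring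
    calc |(i : ℝ)| = |((i : ℝ) + j / 2 + haggLabel s k / 2) + (-((j : ℝ) / 2)) +
          (-((haggLabel s k : ℝ) / 2))| := by rw [← e]
      _ ≤ |(i : ℝ) + j / 2 + haggLabel s k / 2| + |(-((j : ℝ) / 2))| +
          |(-((haggLabel s k : ℝ) / 2))| := abs_add_three _ _ _
      _ = _ := by
        rw [abs_neg, abs_neg, abs_div, abs_div, abs_of_pos (by norm_num : (0 : ℝ) < 2)]
  nlinarith [abs_nonneg (i : ℝ)]

/-- The index box of half-width `B`. [folklore] -/
theorem barlow_index_mem_box {a h : ℝ} (ha : 1 / 2 ≤ a) (hh : 1 / 2 ≤ h) {s : ℤ → ℤ}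
    (hs : IsHaggSeq s) {k i j : ℤ} {M : ℝ} (hM : ‖barlowPos a h s k i j‖ ≤ M) :
    (k, i, j) ∈ (Finset.Icc (-(⌈10 * M⌉₊ : ℤ)) ⌈10 * M⌉₊) ×ˢ
      ((Finset.Icc (-(⌈10 * M⌉₊ : ℤ)) ⌈10 * M⌉₊) ×ˢ (Finset.Icc (-(⌈10 * M⌉₊ : ℤ)) ⌈10 * M⌉₊)) := by
  obtain ⟨hk, hj, hi⟩ := barlow_index_bounds ha hh hs hM
  have hM0 : 0 ≤ M := (norm_nonneg _).trans hM
  have hB : 10 * M ≤ (⌈10 * M⌉₊ : ℝ) := Nat.le_ceil (10 * M)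
  have key : ∀ n : ℤ, |(n : ℝ)| ≤ 10 * M → n ∈ Finset.Icc (-(⌈10 * M⌉₊ : ℤ)) ⌈10 * M⌉₊ := by
    intro n hn
    rw [abs_le] at hn
    rw [Finset.mem_Icc]
    constructor
    · rw [← Int.cast_le (R := ℝ)]
      push_cast
      linarith
    · rw [← Int.cast_le (R := ℝ)]
      push_cast
      linarith
  simp only [Finset.mem_product]
  exact ⟨key k (by linarith), key i hi, key j (by linarith)⟩

/-! ## Local convergence of stackings -/

/-- **Local convergence of Barlow stackings.** If `aₙ → a`, `hₙ → h` (all `≥ 1/2`) and the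
`±1` words `sₙ` converge pointwise to `s`, then for every radius `R` and every `ε > 0`,
eventually the stackings `barlowStacking aₙ hₙ sₙ` and `barlowStacking a h s` are two-way
`ε`-matched on the ball of radius `R` about the origin. [folklore] -/
theorem eventually_ballMatch_barlowStacking {aseq hseq : ℕ → ℝ} {ss : ℕ → ℤ → ℤ} {a h : ℝ}
    {s : ℤ → ℤ} (ha : Tendsto aseq atTop (𝓝 a)) (hh : Tendsto hseq atTop (𝓝 h))
    (hss : ∀ m : ℤ, ∀ᶠ n in atTop, ss n m = s m) (has : ∀ n, 1 / 2 ≤ aseq n)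
    (hhs : ∀ n, 1 / 2 ≤ hseq n) (ha2 : 1 / 2 ≤ a) (hh2 : 1 / 2 ≤ h)
    (hsn : ∀ n, IsHaggSeq (ss n)) (hs : IsHaggSeq s) (R ε : ℝ) (hε : 0 < ε) :
    ∀ᶠ n in atTop, BallMatch ε R 0 (barlowStacking (aseq n) (hseq n) (ss n))
      (barlowStacking a h s) := by
  classical
  set B : ℤ := ((⌈10 * R⌉₊ : ℕ) : ℤ) with hB
  set F := (Finset.Icc (-B) B) ×ˢ ((Finset.Icc (-B) B) ×ˢ (Finset.Icc (-B) B)) with hF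
  -- labels of layers `|k| ≤ B` are eventually those of the limit word
  have hlab : ∀ k ∈ Finset.Icc (-B) B, ∀ᶠ n in atTop, haggLabel (ss n) k = haggLabel s k := by
    intro k _
    have hev : ∀ᶠ n in atTop, ∀ m ∈ Finset.Icc (-|k|) |k|, ss n m = s m :=
      (Filter.eventually_all_finset _).2 fun m _ => hss m
    filter_upwards [hev] with n hn
    exact haggLabel_congr fun m hm => hn m (Finset.mem_Icc.2 (abs_le.1 hm))
  -- every site with indices in the box converges
  have hconv : ∀ t ∈ F, ∀ᶠ n in atTop,
      dist (barlowPos (aseq n) (hseq n) (ss n) t.1 t.2.1 t.2.2)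
        (barlowPos a h s t.1 t.2.1 t.2.2) ≤ ε := by
    rintro ⟨k, i, j⟩ ht
    simp only [hF, Finset.mem_product] at ht
    have hT := tendsto_barlowPos (i := i) (j := j) ha hh (hlab k ht.1)
    exact (Metric.tendsto_nhds.1 hT ε hε).mono fun n hn => hn.le
  have hall : ∀ᶠ n in atTop, ∀ t ∈ F,
      dist (barlowPos (aseq n) (hseq n) (ss n) t.1 t.2.1 t.2.2)
        (barlowPos a h s t.1 t.2.1 t.2.2) ≤ ε :=
    (Filter.eventually_all_finset F).2 hconv
  filter_upwards [hall] with n hn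
  refine ⟨fun p hp hpR => ?_, fun p hp hpR => ?_⟩
  · obtain ⟨k, i, j, rfl⟩ := hp
    rw [dist_zero_right] at hpR
    have hmem := barlow_index_mem_box ha2 hh2 hs hpR
    exact ⟨_, barlowPos_mem k i j, hn (k, i, j) hmem⟩
  · obtain ⟨k, i, j, rfl⟩ := hp
    rw [dist_zero_right] at hpR
    have hmem := barlow_index_mem_box (has n) (hhs n) (hsn n) hpR
    exact ⟨_, barlowPos_mem k i j, hn (k, i, j) hmem⟩

/-! ## Parameter perturbation -/

/-- **Relative position vectors move little with the parameters**: for `a, h ≥ 1/2` and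
`|a - a'|, |h - h'| ≤ η`, the relative position of the sites `(k, i, j)` and `(k', i', j')`
changes by at most `2η` times its length when `(a, h)` is replaced by `(a', h')`. [folklore] -/
theorem dist_sub_sub_le_of_params {a h a' h' η : ℝ} (ha : 1 / 2 ≤ a) (hh : 1 / 2 ≤ h)
    (haa : |a - a'| ≤ η) (hhh : |h - h'| ≤ η) (s : ℤ → ℤ) (k i j k' i' j' : ℤ) :
    dist (barlowPos a h s k i j - barlowPos a h s k' i' j')
        (barlowPos a' h' s k i j - barlowPos a' h' s k' i' j') ≤
      2 * η * dist (barlowPos a h s k i j) (barlowPos a h s k' i' j') := by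
  have hη : 0 ≤ η := (abs_nonneg _).trans haa
  set X : ℝ := ((i : ℝ) - i') + ((j : ℝ) - j') / 2 + ((haggLabel s k : ℝ) - haggLabel s k') / 2
  set Y : ℝ := √3 / 2 * (((j : ℝ) - j') + ((haggLabel s k : ℝ) - haggLabel s k') / 3)
  set Z : ℝ := (k : ℝ) - k'
  have hL : dist (barlowPos a h s k i j - barlowPos a h s k' i' j')
      (barlowPos a' h' s k i j - barlowPos a' h' s k' i' j') ^ 2 =
      ((a - a') * X) ^ 2 + ((a - a') * Y) ^ 2 + ((h - h') * Z) ^ 2 := by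
    rw [EuclideanSpace.dist_sq_eq, Fin.sum_univ_three, Real.dist_eq, Real.dist_eq, Real.dist_eq,
      sq_abs, sq_abs, sq_abs]
    simp only [PiLp.sub_apply, barlowPos_apply_zero, barlowPos_apply_one, barlowPos_apply_two]
    ring
  have hR : dist (barlowPos a h s k i j) (barlowPos a h s k' i' j') ^ 2 =
      (a * X) ^ 2 + (a * Y) ^ 2 + (h * Z) ^ 2 := by
    rw [EuclideanSpace.dist_sq_eq, Fin.sum_univ_three, Real.dist_eq, Real.dist_eq, Real.dist_eq,
      sq_abs, sq_abs, sq_abs]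
    simp only [barlowPos_apply_zero, barlowPos_apply_one, barlowPos_apply_two]
    ring
  have ha2 : (a - a') ^ 2 ≤ η ^ 2 := by
    rw [← sq_abs]; exact pow_le_pow_left₀ (abs_nonneg _) haa 2
  have hh2' : (h - h') ^ 2 ≤ η ^ 2 := by
    rw [← sq_abs]; exact pow_le_pow_left₀ (abs_nonneg _) hhh 2
  have key : dist (barlowPos a h s k i j - barlowPos a h s k' i' j')
      (barlowPos a' h' s k i j - barlowPos a' h' s k' i' j') ^ 2 ≤
      (2 * η * dist (barlowPos a h s k i j) (barlowPos a h s k' i' j')) ^ 2 := by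
    rw [mul_pow, hL, hR]
    have hsc : ∀ {b c : ℝ}, 1 / 2 ≤ b → (b - c) ^ 2 ≤ η ^ 2 → (b - c) ^ 2 ≤ (2 * η) ^ 2 * b ^ 2 := by
      intro b c hb hbc
      have h4 : (1 : ℝ) ≤ 4 * b ^ 2 := by nlinarith
      calc (b - c) ^ 2 ≤ η ^ 2 := hbc
        _ = η ^ 2 * 1 := by ring
        _ ≤ η ^ 2 * (4 * b ^ 2) := mul_le_mul_of_nonneg_left h4 (sq_nonneg η)
        _ = (2 * η) ^ 2 * b ^ 2 := by ring
    have hterm : ∀ {b c W : ℝ}, (b - c) ^ 2 ≤ (2 * η) ^ 2 * b ^ 2 →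
        ((b - c) * W) ^ 2 ≤ (2 * η) ^ 2 * (b * W) ^ 2 := by
      intro b c W hbc
      calc ((b - c) * W) ^ 2 = (b - c) ^ 2 * W ^ 2 := by ring
        _ ≤ (2 * η) ^ 2 * b ^ 2 * W ^ 2 := mul_le_mul_of_nonneg_right hbc (sq_nonneg W)
        _ = (2 * η) ^ 2 * (b * W) ^ 2 := by ring
    have e1 := hterm (W := X) (hsc ha ha2)
    have e2 := hterm (W := Y) (hsc ha ha2)
    have e3 := hterm (W := Z) (hsc hh hh2')
    calc ((a - a') * X) ^ 2 + ((a - a') * Y) ^ 2 + ((h - h') * Z) ^ 2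
        ≤ (2 * η) ^ 2 * (a * X) ^ 2 + (2 * η) ^ 2 * (a * Y) ^ 2 + (2 * η) ^ 2 * (h * Z) ^ 2 :=
          add_le_add (add_le_add e1 e2) e3
      _ = (2 * η) ^ 2 * ((a * X) ^ 2 + (a * Y) ^ 2 + (h * Z) ^ 2) := by ring
  exact (pow_le_pow_iff_left₀ dist_nonneg (by positivity) two_ne_zero).1 key

end Summit.AtomisticToContinuum.Crystallization.Theorems.GscHingeGlue

end
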